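import Summits.HubbardSuperconductivity.HubbardSuperconductivity.Theorems.AnisotropyChordTransferFibre3KernelHarmonicity

/-!
# Route `AnisotropyChord` / H0 rotor rung: the SUBSAMPLING (PERIODISATION) IDENTITY of the torus kernel — `G̃^{(M)}_λ(r) = Σ_{j ∈ (ℤ/q)²} G̃^{(qM)}_λ(r + jM)`, exactly, for every `λ`

Toolkit for the one remaining analytic input of the HOLE₂ tail (memo ROTOR-THEORY-21 §320–§322, PartN37 `TorusKernelQuadraticLaw`;
`…Fibre3TwoHoleBSTail.dualCert_threeQuarter_of_tail` isolates it as the PERIODISATION bound `|2·aKer L 0 r − a_∞(r)| ≤ δ_per(L)`).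
The coarse torus `(ℤ/M)²` is the quotient of the fine torus `(ℤ/qM)²` by `M·(ℤ/q)²`; its zero-mode-removed resolvent is the
periodisation of the fine one.  EXACT, finite Fourier analysis, every real `λ` (same `λ` on both tori), Mathlib + tree imports only:
* `iota` (momentum embedding `m ↦ q·m`), `jshift` (coset shifts `j ↦ jM`), `red` (reduction mod `M`); `iota_val`, `jshift_val`,
  `iota_injective`, `iota_eq_zero_iff`, `epsT_iota` (`ε_{qM}(q·m) = ε_M(m)`), `gres_iota`, `phase_iota` (`φ^{qM}_{q·m}(r) = φ^M_m(r mod M)`);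
* `sum_phase_jshift` — the coset character sum `Σ_{j∈(ℤ/q)²} φ^{qM}_n(jM) = q²·[q ∣ n₁ ∧ q ∣ n₂]` (via `sum_phase_right` on `(ℤ/q)²`);
  `filter_dvd_eq_image`, `sum_filter_dvd` (the divisible momenta are `ι((ℤ/M)²)`);
* ★ `Gres_subsample`: `Σ_{j ∈ (ℤ/q)²} Gres (qM) λ (r + jM) = Gres M λ (r mod M)`;
* ★ `aKer_subsample`: `aKer M λ (r mod M) = Σ_{j ∈ (ℤ/q)²} [aKer (qM) λ (r + jM) − aKer (qM) λ (jM)]` — so the difference of the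
  kernels of two tori `L | L'` is a sum of SECOND-DIFFERENCE-type quantities of the finer kernel at the half-period points
  (`j ≠ 0`; for `q = 2` these are the three points `(M,0),(0,M),(M,M)`, fixed by `r ↦ −r`), the starting point of a dyadic
  (`L, 2L, 4L, …`) Cauchy argument for `a_∞(r) := lim a_L(r)` with an explicit rate and NO continuum integral.
Prover seat `hubbard-h0-rotor-p2` g2; helper for stmt-HubbardSuperconductivity-19089 (`--supports`, helper class).
WHAT THIS IS NOT: nothing here proves superconductivity in the Hubbard model; the rotor TARGET as originally worded stays
FALSE (g15 verdict).  An exact lattice identity serving ONE input (HOLE₂) of ONE conditional reduction (rung 19089); no bound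
is claimed here.  No sorry, no axioms.
-/

set_option linter.dupNamespace false

noncomputable section

open scoped BigOperators
open Complex Finset

namespace Summit.HubbardSuperconductivity.HubbardSuperconductivity.Theorems.AnisotropyChord.Transfer.Fibre3

namespace Subsample

variable (M q : ℕ) [NeZero M] [NeZero q] [NeZero (q * M)]

/-- the momentum embedding `m ↦ q·m` of the coarse torus `(ℤ/M)²` into the fine torus `(ℤ/qM)²`. [folklore] -/
def iota (m : Tor M) : Tor (q * M) :=
  (((q * m.1.val : ℕ) : ZMod (q * M)), ((q * m.2.val : ℕ) : ZMod (q * M)))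

/-- the coset shifts `j ↦ jM` of the fine torus, `j ∈ (ℤ/q)²`. [folklore] -/
def jshift (j : Tor q) : Tor (q * M) :=
  (((M * j.1.val : ℕ) : ZMod (q * M)), ((M * j.2.val : ℕ) : ZMod (q * M)))

/-- reduction of a fine-torus site modulo `M`. [folklore] -/
def red (r : Tor (q * M)) : Tor M := (((r.1.val : ℕ) : ZMod M), ((r.2.val : ℕ) : ZMod M))

omit [NeZero (q * M)] in
/-- values of the embedded momentum. [folklore] -/
theorem iota_val (m : Tor M) : (iota M q m).1.val = q * m.1.val ∧ (iota M q m).2.val = q * m.2.val := by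
  have h1 : q * m.1.val < q * M := Nat.mul_lt_mul_of_pos_left (ZMod.val_lt _) (Nat.pos_of_ne_zero (NeZero.ne q))
  have h2 : q * m.2.val < q * M := Nat.mul_lt_mul_of_pos_left (ZMod.val_lt _) (Nat.pos_of_ne_zero (NeZero.ne q))
  refine ⟨?_, ?_⟩
  · rw [show (iota M q m).1 = ((q * m.1.val : ℕ) : ZMod (q * M)) from rfl, ZMod.val_natCast, Nat.mod_eq_of_lt h1]
  · rw [show (iota M q m).2 = ((q * m.2.val : ℕ) : ZMod (q * M)) from rfl, ZMod.val_natCast, Nat.mod_eq_of_lt h2]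

omit [NeZero (q * M)] in
/-- values of the coset shifts. [folklore] -/
theorem jshift_val (j : Tor q) : (jshift M q j).1.val = M * j.1.val ∧ (jshift M q j).2.val = M * j.2.val := by
  have h1 : M * j.1.val < q * M := by
    have := ZMod.val_lt j.1; nlinarith [Nat.pos_of_ne_zero (NeZero.ne M)]
  have h2 : M * j.2.val < q * M := by
    have := ZMod.val_lt j.2; nlinarith [Nat.pos_of_ne_zero (NeZero.ne M)]
  refine ⟨?_, ?_⟩
  · rw [show (jshift M q j).1 = ((M * j.1.val : ℕ) : ZMod (q * M)) from rfl, ZMod.val_natCast, Nat.mod_eq_of_lt h1]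
  · rw [show (jshift M q j).2 = ((M * j.2.val : ℕ) : ZMod (q * M)) from rfl, ZMod.val_natCast, Nat.mod_eq_of_lt h2]

omit [NeZero (q * M)] in
/-- `ι` is injective. [folklore] -/
theorem iota_injective : Function.Injective (iota M q) := by
  intro m m' h
  have h1 := congrArg (fun n : Tor (q * M) => n.1.val) h
  have h2 := congrArg (fun n : Tor (q * M) => n.2.val) h
  simp only [(iota_val M q m).1, (iota_val M q m').1, (iota_val M q m).2, (iota_val M q m').2] at h1 h2
  have hq : 0 < q := Nat.pos_of_ne_zero (NeZero.ne q)
  have e1 : m.1.val = m'.1.val := Nat.eq_of_mul_eq_mul_left hq h1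
  have e2 : m.2.val = m'.2.val := Nat.eq_of_mul_eq_mul_left hq h2
  exact Prod.ext (ZMod.val_injective M e1) (ZMod.val_injective M e2)

omit [NeZero (q * M)] in
/-- `ι m = 0 ↔ m = 0`. [folklore] -/
theorem iota_eq_zero_iff (m : Tor M) : iota M q m = 0 ↔ m = 0 := by
  constructor
  · intro h
    have h0 : iota M q (0 : Tor M) = 0 := by simp [iota]
    exact iota_injective M q (h.trans h0.symm)
  · intro h; subst h; simp [iota]

omit [NeZero (q * M)] in
/-- `ε` is preserved: `ε_{qM}(q·m) = ε_M(m)`. [folklore] -/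
theorem epsT_iota (m : Tor M) : epsT (q * M) (iota M q m) = epsT M m := by
  unfold epsT
  rw [(iota_val M q m).1, (iota_val M q m).2]
  have hq : (q : ℝ) ≠ 0 := by exact_mod_cast (NeZero.ne q)
  have hM : (M : ℝ) ≠ 0 := by exact_mod_cast (NeZero.ne M)
  have h : ∀ a : ℕ, 2 * Real.pi * ((q * a : ℕ) : ℝ) / ((q * M : ℕ) : ℝ) = 2 * Real.pi * (a : ℝ) / (M : ℝ) := by
    intro a
    push_cast
    field_simp
  rw [h, h]

omit [NeZero (q * M)] in
/-- the resolvent symbol is preserved. [folklore] -/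
theorem gres_iota (lam : ℝ) (m : Tor M) : gres (q * M) lam (iota M q m) = gres M lam m := by
  unfold gres
  rw [epsT_iota]
  simp only [iota_eq_zero_iff]

omit [NeZero (q * M)] in
/-- the phase is preserved: `φ^{qM}_{q·m}(r) = φ^{M}_{m}(r mod M)`. [folklore] -/
theorem phase_iota (m : Tor M) (r : Tor (q * M)) : phase (q * M) (iota M q m) r = phase M m (red M q r) := by
  unfold phase red
  rw [(iota_val M q m).1, (iota_val M q m).2]
  have hq : (q : ℂ) ≠ 0 := by exact_mod_cast (NeZero.ne q)
  have hT : (((q * m.1.val * r.1.val + q * m.2.val * r.2.val : ℕ) : ℂ) / ((q * M : ℕ) : ℂ))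
      = (((m.1.val * r.1.val + m.2.val * r.2.val : ℕ) : ℂ) / (M : ℂ)) := by
    push_cast
    field_simp
  rw [hT, exp_natCast_mod M (m.1.val * r.1.val + m.2.val * r.2.val)]
  conv_rhs => rw [ZMod.val_natCast, ZMod.val_natCast,
    exp_natCast_mod M (m.1.val * (r.1.val % M) + m.2.val * (r.2.val % M))]
  have hmod : (m.1.val * r.1.val + m.2.val * r.2.val) % M = (m.1.val * (r.1.val % M) + m.2.val * (r.2.val % M)) % M :=
    (Nat.ModEq.add (Nat.ModEq.mul_left _ (Nat.mod_modEq _ _)) (Nat.ModEq.mul_left _ (Nat.mod_modEq _ _))).symm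
  first | rfl | rw [hmod]

omit [NeZero (q * M)] in
/-- the coset character sum: `Σ_{j ∈ (ℤ/q)²} φ^{qM}_n(jM) = q²·[q ∣ n₁ ∧ q ∣ n₂]`. [folklore] -/
theorem sum_phase_jshift (n : Tor (q * M)) :
    ∑ j : Tor q, phase (q * M) n (jshift M q j)
      = if (q ∣ n.1.val ∧ q ∣ n.2.val) then ((q : ℂ) ^ 2) else 0 := by
  have hM : (M : ℂ) ≠ 0 := by exact_mod_cast (NeZero.ne M)
  set nq : Tor q := (((n.1.val : ℕ) : ZMod q), ((n.2.val : ℕ) : ZMod q)) with hnq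
  have hph : ∀ j : Tor q, phase (q * M) n (jshift M q j) = phase q nq j := by
    intro j
    unfold phase
    rw [(jshift_val M q j).1, (jshift_val M q j).2]
    have hT : (((n.1.val * (M * j.1.val) + n.2.val * (M * j.2.val) : ℕ) : ℂ) / ((q * M : ℕ) : ℂ))
        = (((n.1.val * j.1.val + n.2.val * j.2.val : ℕ) : ℂ) / (q : ℂ)) := by
      push_cast
      field_simp
    rw [hT, exp_natCast_mod q (n.1.val * j.1.val + n.2.val * j.2.val)]
    conv_rhs => rw [hnq, ZMod.val_natCast, ZMod.val_natCast,
      exp_natCast_mod q (n.1.val % q * j.1.val + n.2.val % q * j.2.val)]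
    have hmod : (n.1.val * j.1.val + n.2.val * j.2.val) % q = (n.1.val % q * j.1.val + n.2.val % q * j.2.val) % q :=
      (Nat.ModEq.add (Nat.ModEq.mul_right _ (Nat.mod_modEq _ _)) (Nat.ModEq.mul_right _ (Nat.mod_modEq _ _))).symm
    first | rfl | rw [hmod]
  rw [Finset.sum_congr rfl fun j _ => hph j, sum_phase_right]
  have hiff : nq = 0 ↔ (q ∣ n.1.val ∧ q ∣ n.2.val) := by
    rw [hnq, Prod.mk_eq_zero, ZMod.natCast_eq_zero_iff, ZMod.natCast_eq_zero_iff]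
  by_cases h : (q ∣ n.1.val ∧ q ∣ n.2.val)
  · rw [if_pos (hiff.mpr h), if_pos h]
  · rw [if_neg (fun h' => h (hiff.mp h')), if_neg h]

/-- the divisible momenta are exactly the image of `ι`. [folklore] -/
theorem filter_dvd_eq_image :
    (Finset.univ.filter fun n : Tor (q * M) => q ∣ n.1.val ∧ q ∣ n.2.val) = Finset.univ.image (iota M q) := by
  ext n
  simp only [Finset.mem_filter, Finset.mem_univ, true_and, Finset.mem_image]
  constructor
  · rintro ⟨⟨a, ha⟩, ⟨b, hb⟩⟩
    refine ⟨(((a : ℕ) : ZMod M), ((b : ℕ) : ZMod M)), ?_⟩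
    have hq : 0 < q := Nat.pos_of_ne_zero (NeZero.ne q)
    have haM : a < M := by
      have := ZMod.val_lt n.1; rw [ha] at this; nlinarith
    have hbM : b < M := by
      have := ZMod.val_lt n.2; rw [hb] at this; nlinarith
    refine Prod.ext ?_ ?_
    · apply ZMod.val_injective
      rw [(iota_val M q _).1, ZMod.val_natCast, Nat.mod_eq_of_lt haM, ha]
    · apply ZMod.val_injective
      rw [(iota_val M q _).2, ZMod.val_natCast, Nat.mod_eq_of_lt hbM, hb]
  · rintro ⟨m, rfl⟩
    exact ⟨⟨m.1.val, (iota_val M q m).1⟩, ⟨m.2.val, (iota_val M q m).2⟩⟩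

/-- reindexing the divisible momenta by the coarse torus. [folklore] -/
theorem sum_filter_dvd (F : Tor (q * M) → ℝ) :
    ∑ n ∈ Finset.univ.filter (fun n : Tor (q * M) => q ∣ n.1.val ∧ q ∣ n.2.val), F n
      = ∑ m : Tor M, F (iota M q m) := by
  rw [filter_dvd_eq_image, Finset.sum_image fun m _ m' _ h => iota_injective M q h]

/-- ★ **SUBSAMPLING IDENTITY** (exact, every `λ`): summing the fine-torus resolvent over the `q²` cosets of `M·(ℤ/q)²` gives the
coarse-torus resolvent: `Σ_{j ∈ (ℤ/q)²} G̃^{(qM)}_λ(r + jM) = G̃^{(M)}_λ(r mod M)`. [folklore] -/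
theorem Gres_subsample (lam : ℝ) (r : Tor (q * M)) :
    ∑ j : Tor q, Gres (q * M) lam (r + jshift M q j) = Gres M lam (red M q r) := by
  have hM : (M : ℝ) ≠ 0 := by exact_mod_cast (NeZero.ne M)
  have hq : (q : ℝ) ≠ 0 := by exact_mod_cast (NeZero.ne q)
  unfold Gres
  rw [← Finset.sum_div, Finset.sum_comm]
  -- inner coset sum, momentum by momentum
  have hin : ∀ n : Tor (q * M), ∑ j : Tor q, gres (q * M) lam n * (phase (q * M) n (r + jshift M q j)).re
      = gres (q * M) lam n * (phase (q * M) n r).re * (if (q ∣ n.1.val ∧ q ∣ n.2.val) then ((q : ℝ) ^ 2) else 0) := by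
    intro n
    rw [← Finset.mul_sum, mul_assoc]
    congr 1
    have h := sum_phase_jshift M q n
    have h2 : ∑ j : Tor q, (phase (q * M) n (r + jshift M q j)).re
        = (phase (q * M) n r * ∑ j : Tor q, phase (q * M) n (jshift M q j)).re := by
      rw [Finset.mul_sum, Complex.re_sum]
      refine Finset.sum_congr rfl fun j _ => ?_
      rw [phase_add]
    rw [h2, h]
    split_ifs
    · rw [show ((q : ℂ) ^ 2) = (((q : ℝ) ^ 2 : ℝ) : ℂ) by push_cast; ring, Complex.mul_re, Complex.ofReal_re,
        Complex.ofReal_im, mul_zero, sub_zero]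
    · simp
  rw [Finset.sum_congr rfl fun n _ => hin n]
  simp_rw [mul_ite, mul_zero]
  rw [← Finset.sum_filter, sum_filter_dvd]
  simp_rw [gres_iota, phase_iota]
  rw [← Finset.sum_mul]
  push_cast
  field_simp

omit [NeZero (q * M)] in
/-- `red (jshift j) = 0`. [folklore] -/
theorem red_jshift (j : Tor q) : red M q (jshift M q j) = 0 := by
  unfold red
  rw [(jshift_val M q j).1, (jshift_val M q j).2]
  refine Prod.ext ?_ ?_ <;> simp

/-- ★ **SUBSAMPLING FOR THE KERNEL DIFFERENCES:** `a^{(M)}_λ(r mod M) = Σ_{j ∈ (ℤ/q)²} [a^{(qM)}_λ(r + jM) − a^{(qM)}_λ(jM)]`. [folklore] -/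
theorem aKer_subsample (lam : ℝ) (r : Tor (q * M)) :
    aKer M lam (red M q r) = ∑ j : Tor q, (aKer (q * M) lam (r + jshift M q j) - aKer (q * M) lam (jshift M q j)) := by
  unfold aKer
  rw [Finset.sum_sub_distrib]
  have h0 := Gres_subsample M q lam 0
  simp only [zero_add] at h0
  have hr := Gres_subsample M q lam r
  have hred0 : red M q (0 : Tor (q * M)) = 0 := by
    unfold red; simp
  rw [hred0] at h0
  rw [← hr, ← h0]
  simp only [Finset.sum_sub_distrib, sub_sub_sub_cancel_left]

end Subsample

end Summit.HubbardSuperconductivity.HubbardSuperconductivity.Theorems.AnisotropyChord.Transfer.Fibre3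

end
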